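import Mathlib
import HarnessLib.Audit
import Summits.PneNP.PneNP.Theorems.PstarCrossCaseTProduct
import Summits.PneNP.PneNP.Theorems.PstarNorUnitMixed

/-!
# The blind free CROSS gate, regime T (node N3): REDUCTION to the zero row, the all-(NOR) product row, and the single unit (O2 / E1; prover-1 g23)

FRONTIER range-avoidance ladder, rung F-N3 (`stmt-PneNP-19007`), cell `pnp-ideate`; restricted-model proof complexity — nothing here bears on `P` versus `NP`.

Node N3 (`PstarCrossNodes.CrossCaseT`).  `PstarCrossCaseTRows.caseT_row` sorts `q_m` against any real chord `e'` into `0`, `u_{e'}` ((EQ) — closed by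
`PstarCrossCaseTEqUnique.crossCaseT_eq`), a pure non-degenerate product (then every real chord is (NOR) w.r.t. `q_m + 1`, `PstarCrossCaseTProduct.caseT_product_nor`),
or `u_{e'} +` a non-degenerate product — in which case `e'` is an (EXC) chord against `q := q_m + 1` and `PstarNorUnitExcCore.exc_unit_core` makes it a UNIT
(`D e' = {j₁, j₂}`, literals `σ, τ`, polar formula); two units coincide (`PstarNorUnitMixed.D_eq_of_excUnits`, `eq_of_fundamental_eq`).  Hence:

* **`crossCaseT_reduction`** — regime T with a real chord: `#J₀ ≤ 5`, OR `q_m ≡ 0`, OR `q_m` is a non-degenerate product and every real chord is (NOR)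
  w.r.t. `q_m + 1`, OR the real chords are a SINGLE unit `e₀` w.r.t. `q_m + 1`.  These three rows are what remains of N3.
-/

set_option linter.dupNamespace false -- `Summit.PneNP.PneNP.…`: summit = sub-problem name (D-0017 single-conjunct layout)

open Finset Module Literature.Computability.Complexity
open Summit.PneNP.PneNP.Theorems.PstarTyped (Typed)
open Summit.PneNP.PneNP.Theorems.PstarSALevel (BoundaryExpanding SimpleOverlap)
open Summit.PneNP.PneNP.Theorems.PstarGapLinearised (andPair)
open Summit.PneNP.PneNP.Theorems.PstarCubeIdeals (IsAffineFn IsQuadFn)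
open Summit.PneNP.PneNP.Theorems.PstarProductRank (qform polar)
open Summit.PneNP.PneNP.Theorems.PstarPathRank (AndAdj)
open Summit.PneNP.PneNP.Theorems.PstarReadSumset (V2)
open Summit.PneNP.PneNP.Theorems.PstarForcing (not_rank_four_of_mul)
open Summit.PneNP.PneNP.Theorems.PstarChordSystem (ChordSystem)
open Summit.PneNP.PneNP.Theorems.PstarChordBridgeTools
open Summit.PneNP.PneNP.Theorems.PstarChordBridge
open Summit.PneNP.PneNP.Theorems.PstarChordBridgeForcing (gam sys_u_eq rank_four_of_wf)
open Summit.PneNP.PneNP.Theorems.PstarChordBridgeFundamental (eq_of_fundamental_eq)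
open Summit.PneNP.PneNP.Theorems.PstarChordBridgeBasis (qDir polarDir)
open Summit.PneNP.PneNP.Theorems.PstarCrossData (CrossData)
open Summit.PneNP.PneNP.Theorems.PstarCrossSystem
open Summit.PneNP.PneNP.Theorems.PstarCrossCaseT (forcing_of_real)
open Summit.PneNP.PneNP.Theorems.PstarCrossCaseU2 (u_add)
open Summit.PneNP.PneNP.Theorems.PstarCrossCaseU2Touch (card_J₀_le)
open Summit.PneNP.PneNP.Theorems.PstarCrossCaseTRows (caseT_row)
open Summit.PneNP.PneNP.Theorems.PstarCrossCaseTEqUnique (crossCaseT_eq)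
open Summit.PneNP.PneNP.Theorems.PstarCrossCaseTProduct (caseT_product_nor)
open Summit.PneNP.PneNP.Theorems.PstarCrossNoCompanion (isQuadFn_shift)
open Summit.PneNP.PneNP.Theorems.PstarNorUnitExcCore (exc_unit_core)
open Summit.PneNP.PneNP.Theorems.PstarNorUnitMixed (D_eq_of_excUnits)

namespace Summit.PneNP.PneNP.Theorems.PstarCrossCaseTReduction

variable {n m : ℕ}

section

variable (I : LocalMap 4 n m) {r : ℕ} {B : BridgeData n m} {e_p e_q g₀ : Fin m}

/-- **The fourth row makes the chord a unit w.r.t. `q_m + 1`.**  If `u_{e'} + q_m = ν₁ν₂` (non-degenerate) then `D e' = {j₁, j₂}` with the unit data,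
unless `#J₀ ≤ 5`. -/
theorem caseT_unit_of_row (hI : I.IsPure xorAndPred) (hT : Typed I) (hS : SimpleOverlap I) (hB : BoundaryExpanding r I)
    (hD : CrossData I r B e_p e_q g₀) {mv : V2} (hmvT : mv = (0, 1) ∨ mv = (1, 1))
    (hline : ∀ e ∈ (B.N.erase e_q).erase e_p,
      (((sys I B).vsys e_p e_q).ρ e 0 = 0 ∨ ((sys I B).vsys e_p e_q).ρ e 0 = mv) ∧
      (((sys I B).vsys e_p e_q).ρ' e 0 = 0 ∨ ((sys I B).vsys e_p e_q).ρ' e 0 = mv))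
    (hread : ∀ e ∈ (B.N.erase e_q).erase e_p, ((sys I B).vsys e_p e_q).ρ e 0 ≠ 0 ∨ ((sys I B).vsys e_p e_q).ρ' e 0 ≠ 0)
    {e' : Fin m} (he' : e' ∈ (B.N.erase e_q).erase e_p) {ν₁ ν₂ : (Fin n → ZMod 2) → ZMod 2} (hν₁ : IsAffineFn ν₁) (hν₂ : IsAffineFn ν₂)
    (hrow : ∀ x, (sys I B).u e' x + qDir I B mv x = ν₁ x * ν₂ x) :
    B.J₀.card ≤ 5 ∨
    ∃ j₁ j₂ : Fin m, ∃ σ τ : Fin n, j₁ ≠ j₂ ∧ B.D e' = {j₁, j₂} ∧ Disjoint (andPair I j₁) (andPair I j₂) ∧ σ ∈ andPair I j₁ ∧ τ ∈ andPair I j₂ ∧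
      (∀ v : Fin n, (ν₁ (Pi.single v 1) ≠ ν₁ 0 ∨ ν₂ (Pi.single v 1) ≠ ν₂ 0) ↔ (v = σ ∨ v = τ)) ∧
      ∀ v w : Fin n, polarDir I B mv (Pi.single v 1) (Pi.single w 1) =
        (if AndAdj I (B.D e') v w then 1 else 0) + (if (v = σ ∧ w = τ) ∨ (v = τ ∧ w = σ) then 1 else 0) := by
  have hW := hD.wf
  have he'N : e' ∈ B.N := mem_of_mem_erase (mem_of_mem_erase he')
  have he'J : e' ∈ B.J₀ := hW.hN he'N
  have e01 : ∀ t : ZMod 2, t = 0 ∨ t = 1 := by decide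
  have hr : (B.J₀ ∪ B.G₁ ∪ B.G₂).card ≤ r := by
    refine le_trans (card_le_card ?_) hD.rad
    exact union_subset_union (union_subset_union subset_rfl (subset_insert g₀ B.G₁)) subset_rfl
  have hd₁ : Disjoint B.G₁ B.J₀ := Finset.disjoint_of_subset_left (subset_insert g₀ B.G₁) hD.disj₁
  have heG : e' ∉ B.G₁ ∪ B.G₂ := by
    rw [mem_union, not_or]
    exact ⟨fun h => Finset.disjoint_left.1 hd₁ h he'J, fun h => Finset.disjoint_left.1 hD.disj₂ h he'J⟩
  have hqB := isQuadFn_shift I B mv 1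
  have hZ' : ∀ x, qDir I B mv x + 1 = 0 → qform (B.D e') (fun j => I.vars j 2) (fun j => I.vars j 3) x = 1 + gam B e' := fun x hx => by
    have hu : (sys I B).u e' x = 1 := by
      rcases e01 ((sys I B).u e' x) with h0 | h1
      · have h := (forcing_of_real I hI hT hD hmvT hline hread he' h0).2
        rw [h, zero_add] at hx
        exact absurd hx one_ne_zero
      · exact h1
    rw [sys_u_eq] at hu
    have e2 : ∀ g Q : ZMod 2, g + Q = 1 → Q = 1 + g := by decide
    exact e2 _ _ hu
  have hEXC' : ∀ x, qform (B.D e') (fun j => I.vars j 2) (fun j => I.vars j 3) x = (qDir I B mv x + 1) + ν₁ x * ν₂ x + (1 + gam B e') := fun x => by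
    have h := hrow x
    rw [sys_u_eq] at h
    have e3 : ∀ g Q q N : ZMod 2, g + Q + q = N → Q = q + 1 + N + (1 + g) := by decide
    exact e3 _ _ _ _ h
  rcases exc_unit_core I hI hS hB hW hr he'N heG mv hqB hZ' hν₁ hν₂ hEXC' with ⟨κ', hEQ⟩ | ⟨j₁, j₂, σ, τ, hj, hDe, hdisj, hσ, hτ, hsupp, hpol, -⟩
  · -- (EQ) after all: `q_m = u_{e'}` up to a constant, which is `0` on `Z(u_{e'})`
    left
    have hq' : ∀ x, qDir I B mv x = (sys I B).u e' x + (κ' + 1 + gam B e') := fun x => by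
      rw [sys_u_eq, hEQ x]
      have e5 : ∀ a g k : ZMod 2, a = g + (a + 1 + k) + (k + 1 + g) := by decide
      exact e5 _ _ _
    -- the constant vanishes (else `u_{e'}` has no zero: constant, contradicting rank four)
    have hrank := rank_four_of_wf I hI hS hB hW (card_J₀_le I hD) he'N
    by_cases hc : κ' + 1 + gam B e' = 0
    · exact crossCaseT_eq I hI hT hS hB hD hmvT hline hread he' fun x => by rw [hq' x, hc, add_zero]
    · exfalso
      have hc1 : κ' + 1 + gam B e' = 1 := (e01 _).resolve_left hc
      have hu1 : ∀ x, (sys I B).u e' x = 1 := fun x => by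
        rcases e01 ((sys I B).u e' x) with h0 | h1
        · have h := (forcing_of_real I hI hT hD hmvT hline hread he' h0).2
          rw [hq' x, h0, hc1] at h
          exact absurd h (by decide)
        · exact h1
      obtain ⟨v, hv⟩ := PstarForcing.exists_ne_of_rank_four (u_add I B e') hrank
      exact hv (by rw [hu1, hu1])
  · exact Or.inr ⟨j₁, j₂, σ, τ, hj, hDe, hdisj, hσ, hτ, hsupp, hpol⟩

/-- **The N3 reduction.**  See the module docstring. -/
theorem crossCaseT_reduction (hI : I.IsPure xorAndPred) (hT : Typed I) (hS : SimpleOverlap I) (hB : BoundaryExpanding r I)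
    (hD : CrossData I r B e_p e_q g₀) (hne : ((B.N.erase e_q).erase e_p).Nonempty) {mv : V2} (hmvT : mv = (0, 1) ∨ mv = (1, 1))
    (hline : ∀ e ∈ (B.N.erase e_q).erase e_p,
      (((sys I B).vsys e_p e_q).ρ e 0 = 0 ∨ ((sys I B).vsys e_p e_q).ρ e 0 = mv) ∧
      (((sys I B).vsys e_p e_q).ρ' e 0 = 0 ∨ ((sys I B).vsys e_p e_q).ρ' e 0 = mv))
    (hread : ∀ e ∈ (B.N.erase e_q).erase e_p, ((sys I B).vsys e_p e_q).ρ e 0 ≠ 0 ∨ ((sys I B).vsys e_p e_q).ρ' e 0 ≠ 0) :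
    B.J₀.card ≤ 5 ∨
    (∀ x, qDir I B mv x = 0) ∨
    (∃ μ₁ μ₂ : (Fin n → ZMod 2) → ZMod 2, IsAffineFn μ₁ ∧ IsAffineFn μ₂ ∧
      (∃ z, μ₁ z ≠ μ₁ 0) ∧ (∃ z, μ₂ z ≠ μ₂ 0) ∧ (∃ z, μ₁ z + μ₁ 0 ≠ μ₂ z + μ₂ 0) ∧ (∀ x, qDir I B mv x = μ₁ x * μ₂ x) ∧
      ∀ e' ∈ (B.N.erase e_q).erase e_p, ∃ a b : Fin n → ZMod 2, polarDir I B mv a b = 1 ∧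
        (∀ x, qDir I B mv x + 1 =
          (polarDir I B mv x b + ((qDir I B mv b + 1) + (qDir I B mv 0 + 1))) * (polarDir I B mv x a + ((qDir I B mv a + 1) + (qDir I B mv 0 + 1))) + 1) ∧
        ∃ m₁ m₂ : (Fin n → ZMod 2) → ZMod 2, IsAffineFn m₁ ∧ IsAffineFn m₂ ∧
          ∀ x, (sys I B).u e' x + 1 =
            (polarDir I B mv x b + ((qDir I B mv b + 1) + (qDir I B mv 0 + 1)) + 1) * m₁ x +
            (polarDir I B mv x a + ((qDir I B mv a + 1) + (qDir I B mv 0 + 1)) + 1) * m₂ x) ∨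
    (∃ e₀, (B.N.erase e_q).erase e_p = {e₀} ∧ ∃ ν₁ ν₂ : (Fin n → ZMod 2) → ZMod 2, IsAffineFn ν₁ ∧ IsAffineFn ν₂ ∧
      (∀ x, (sys I B).u e₀ x + qDir I B mv x = ν₁ x * ν₂ x) ∧
      ∃ j₁ j₂ : Fin m, ∃ σ τ : Fin n, j₁ ≠ j₂ ∧ B.D e₀ = {j₁, j₂} ∧ Disjoint (andPair I j₁) (andPair I j₂) ∧ σ ∈ andPair I j₁ ∧ τ ∈ andPair I j₂ ∧
        (∀ v : Fin n, (ν₁ (Pi.single v 1) ≠ ν₁ 0 ∨ ν₂ (Pi.single v 1) ≠ ν₂ 0) ↔ (v = σ ∨ v = τ)) ∧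
        ∀ v w : Fin n, polarDir I B mv (Pi.single v 1) (Pi.single w 1) =
          (if AndAdj I (B.D e₀) v w then 1 else 0) + (if (v = σ ∧ w = τ) ∨ (v = τ ∧ w = σ) then 1 else 0)) := by
  classical
  by_cases h5 : B.J₀.card ≤ 5
  · exact Or.inl h5
  by_cases h0 : ∀ x, qDir I B mv x = 0
  · exact Or.inr (Or.inl h0)
  -- no chord is (EQ); sort every chord into "pure product" or "unit"
  have hsort : ∀ e' ∈ (B.N.erase e_q).erase e_p,
      (∃ μ₁ μ₂ : (Fin n → ZMod 2) → ZMod 2, IsAffineFn μ₁ ∧ IsAffineFn μ₂ ∧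
        (∃ z, μ₁ z ≠ μ₁ 0) ∧ (∃ z, μ₂ z ≠ μ₂ 0) ∧ (∃ z, μ₁ z + μ₁ 0 ≠ μ₂ z + μ₂ 0) ∧ ∀ x, qDir I B mv x = μ₁ x * μ₂ x) ∨
      (∃ ν₁ ν₂ : (Fin n → ZMod 2) → ZMod 2, IsAffineFn ν₁ ∧ IsAffineFn ν₂ ∧ (∀ x, (sys I B).u e' x + qDir I B mv x = ν₁ x * ν₂ x) ∧
        ∃ j₁ j₂ : Fin m, ∃ σ τ : Fin n, j₁ ≠ j₂ ∧ B.D e' = {j₁, j₂} ∧ Disjoint (andPair I j₁) (andPair I j₂) ∧ σ ∈ andPair I j₁ ∧ τ ∈ andPair I j₂ ∧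
          (∀ v : Fin n, (ν₁ (Pi.single v 1) ≠ ν₁ 0 ∨ ν₂ (Pi.single v 1) ≠ ν₂ 0) ↔ (v = σ ∨ v = τ)) ∧
          ∀ v w : Fin n, polarDir I B mv (Pi.single v 1) (Pi.single w 1) =
            (if AndAdj I (B.D e') v w then 1 else 0) + (if (v = σ ∧ w = τ) ∨ (v = τ ∧ w = σ) then 1 else 0)) := by
    intro e' he'
    rcases caseT_row I hI hT hS hB hD hmvT hline hread he' with (hz | heq) | ⟨μ₁, μ₂, h₁, h₂, hn₁, hn₂, hn, hprod | hrow⟩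
    · exact absurd hz h0
    · exact absurd (crossCaseT_eq I hI hT hS hB hD hmvT hline hread he' heq) h5
    · exact Or.inl ⟨μ₁, μ₂, h₁, h₂, hn₁, hn₂, hn, hprod⟩
    · rcases caseT_unit_of_row I hI hT hS hB hD hmvT hline hread he' h₁ h₂ hrow with h | h
      · exact absurd h h5
      · exact Or.inr ⟨μ₁, μ₂, h₁, h₂, hrow, h⟩
  by_cases hprod : ∃ μ₁ μ₂ : (Fin n → ZMod 2) → ZMod 2, IsAffineFn μ₁ ∧ IsAffineFn μ₂ ∧
      (∃ z, μ₁ z ≠ μ₁ 0) ∧ (∃ z, μ₂ z ≠ μ₂ 0) ∧ (∃ z, μ₁ z + μ₁ 0 ≠ μ₂ z + μ₂ 0) ∧ ∀ x, qDir I B mv x = μ₁ x * μ₂ x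
  · obtain ⟨μ₁, μ₂, h₁, h₂, hn₁, hn₂, hn, hq⟩ := hprod
    exact Or.inr (Or.inr (Or.inl ⟨μ₁, μ₂, h₁, h₂, hn₁, hn₂, hn, hq, fun e' he' =>
      caseT_product_nor I hI hT hS hB hD hmvT hline hread h₁ h₂ hn₁ hn₂ hn hq he'⟩))
  · -- every real chord is a unit; units are unique
    right; right; right
    have hunit : ∀ e' ∈ (B.N.erase e_q).erase e_p, _ := fun e' he' => (hsort e' he').resolve_left hprod
    obtain ⟨e₀, he₀⟩ := hne
    refine ⟨e₀, eq_singleton_iff_unique_mem.2 ⟨he₀, fun e' he' => ?_⟩, hunit e₀ he₀⟩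
    obtain ⟨_, _, -, -, -, j₁, j₂, σ, τ, -, hDe, hdisj, hσ, hτ, -, hpol⟩ := hunit e₀ he₀
    obtain ⟨_, _, -, -, -, k₁, k₂, σ', τ', hk, hDe', hdisj', hσ', hτ', -, hpol'⟩ := hunit e' he'
    have hW := hD.wf
    have he₀N : e₀ ∈ B.N := mem_of_mem_erase (mem_of_mem_erase he₀)
    have he'N : e' ∈ B.N := mem_of_mem_erase (mem_of_mem_erase he')
    have hDD : B.D e' = B.D e₀ := D_eq_of_excUnits I hI hS hDe hdisj hσ hτ hpol hk hDe' hdisj' hσ' hτ' hpol'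
    have h1 : e₀ ∉ B.D e₀ := fun h => (mem_sdiff.1 (hW.hD e₀ he₀N h)).2 he₀N
    have h2 : e' ∉ B.D e₀ := fun h => (mem_sdiff.1 (hW.hD e₀ he₀N h)).2 he'N
    exact (eq_of_fundamental_eq I hI hS h1 h2 (hW.hDeven e₀ he₀N) (hDD ▸ hW.hDeven e' he'N)).symm

end

end Summit.PneNP.PneNP.Theorems.PstarCrossCaseTReduction
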